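import Summits.Schanuel.Schanuel.Theorems.RootDecomp1BMovingZero14

/-!
# RootDecomp1BMovingZero — lens 4, generation 37 «SUB-PIECE A UNCONDITIONAL» (lane B-R24 (a)): the two print-fact binders `RoucheMaps` (A1) and `IsolatedZeroLowerBound` (A2) of part 04 DISCHARGED by sorry-free proofs BY NAME (`roucheMaps_holds`, `isolatedZeroLowerBound_holds`) from the tree SCV library; `analyticMovingZero_holds` binder-free; the (1|ρ) cell modulo five named inputs — continuation (RootDecomp1BMovingZero15): §2 FACT A1 `roucheMaps_holds` DISCHARGED (finiteness, Remmert persistence, continuity method) + §3 READ-OUTS `analyticMovingZero_holds`, `movingZeroApprox_of_three_facts`, `four_le_polarDeg_one_of_three_facts`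

(lens-4 g37 HOME kernel PieceADischarge.lean dc12d931…, 549 l, imports tree MovingZero13 + Literature AnalyticCover / OsgoodProofs / AnalyticSetOpenProjection / AnalyticSetFiniteMaps / AnalyticSetZeroDimensional / AnalyticSetIntersectionDimension; CLAIM L1976, critic ACK + CHECKLIST B-g37 L1979, NODE L2000 / REQUEST L2001, critic VERDICT L2007 (crit g8: CLEARED — THEOREM ×2, one per named def : Prop discharged BY NAME; lens-4 tally THEOREM ×4 + CELL ×2; PORT GO `--supports stmt-Schanuel-24622`, kind proof); port by census-1 gen 17 as `RootDecomp1BMovingZero14`–`15`: 14 = §1 FACT A2 `isolatedZeroLowerBound_holds : IsolatedZeroLowerBound` (canonical SHADOW EQUATIONS of the graph system via `Literature.Analysis.Complex.SCV.exists_shadow_equation` + one-variable order + local Lipschitz of the shadow); 15 = §2 FACT A1 `roucheMaps_holds : RoucheMaps` (finiteness + isolation on the compact ball ∩ zero set, persistence by Remmert open projection, continuity method along the straight-line homotopy) + §3 READ-OUTS `analyticMovingZero_holds : AnalyticMovingZero`, `approxOfIsolated_of_isolatedPointBound`, `movingZeroApprox_of_three_facts : CurveSelection → AxRankBoundLaurent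 → IsolatedPointBound → ∀ ρ, MovingZeroApprox ρ`, `four_le_polarDeg_one_of_three_facts` (+ swap / hyper / ρ_T) — the cell's named inputs drop from SEVEN to FIVE.
PORT EDITS: the axiom-guard section and `import HarnessLib` (unused) dropped; `set_option linter.dupNamespace false` dropped; statements and proofs verbatim (theorem types = the tree defs BY NAME). `--supports stmt-Schanuel-24622`; no census credit carried; rung 0 — nothing here proves Schanuel or 32406.)
-/

noncomputable section

open Complex Filter Topology Metric Set
open Literature.Analysis.Complex.SCV (IsZeroSetAt)
open Literature.Geometry.Kaehler.SCV (IsRegPt regLocus)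

namespace Summit.Schanuel.Schanuel.Theorems.RootDecomp1BMovingZero

/-! ## §2  FACT A1 `RoucheMaps` DISCHARGED — finiteness, persistence (Remmert), continuity method -/

section FactA1

/-- **Zeros in a ball, none on the boundary sphere: finitely many, all isolated.**  For `h : ℂ² → ℂ²`
analytic near the closed (sup-norm) ball `closedBall w₀ r` with `h ≠ 0` on `sphere w₀ r`, the zero set
`{w ∈ ball w₀ r | h w = 0}` is compact and locally cut out by two holomorphic equations, hence finite, and
every point of `ℂ²` has a punctured neighbourhood missing it. [cite: Chirka1989, §3.3 Prop. 1, p. 32] -/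
theorem finite_zeros_ball {h : ℂ × ℂ → ℂ × ℂ} {w₀ : ℂ × ℂ} {r : ℝ}
    (hh : AnalyticOnNhd ℂ h (closedBall w₀ r)) (hsph : ∀ w ∈ sphere w₀ r, h w ≠ 0) :
    {w ∈ ball w₀ r | h w = 0}.Finite ∧ ∀ z, ∀ᶠ w in 𝓝[≠] z, w ∉ {w ∈ ball w₀ r | h w = 0} := by
  set F : Set (ℂ × ℂ) := {w ∈ ball w₀ r | h w = 0} with hF
  have hFeq : F = closedBall w₀ r ∩ h ⁻¹' {0} := by
    ext w
    simp only [hF, mem_setOf_eq, mem_inter_iff, mem_preimage, mem_singleton_iff]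
    constructor
    · rintro ⟨hw, h0⟩
      exact ⟨ball_subset_closedBall hw, h0⟩
    · rintro ⟨hw, h0⟩
      refine ⟨?_, h0⟩
      have hns : w ∉ sphere w₀ r := fun hs => hsph w hs h0
      rw [mem_closedBall] at hw
      rw [mem_sphere] at hns
      exact mem_ball.2 (lt_of_le_of_ne hw hns)
  have hcpt : IsCompact F := by
    rw [hFeq]
    exact (isCompact_closedBall w₀ r).of_isClosed_subset
      (hh.continuousOn.preimage_isClosed_of_isClosed isClosed_closedBall isClosed_singleton)
      inter_subset_left
  have hzs : ∀ x ∈ F, IsZeroSetAt F x := by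
    intro x hx
    refine ⟨ball w₀ r, isOpen_ball, hx.1, 2,
      fun w => (ContinuousLinearEquiv.finTwoArrow ℂ ℂ).symm (h w), ?_, ?_⟩
    · intro w hw
      exact ((ContinuousLinearEquiv.finTwoArrow ℂ ℂ).symm.differentiableAt.comp w
        (hh w (ball_subset_closedBall hw)).differentiableAt).differentiableWithinAt
    · ext w
      simp only [hF, mem_inter_iff, mem_setOf_eq, mem_preimage, mem_singleton_iff,
        EmbeddingLike.map_eq_zero_iff]
      tauto
  exact ⟨Literature.Geometry.Kaehler.SCV.finite_of_isCompact_of_isZeroSetAt hcpt hzs,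
    Literature.Geometry.Kaehler.SCV.eventually_notMem_of_isCompact_of_isZeroSetAt hcpt hzs⟩

/-- **Persistence of an isolated zero in a holomorphic family** (Remmert's open mapping theorem for
`(s, w) ↦ (s, H(s, w))`): if `H : ℂ × ℂ² → ℂ²` is holomorphic on an open `Ω₀ ∋ (s₀, w₁)`, `H(s₀, w₁) = 0`
and `w₁` is an isolated zero of `H(s₀, ·)`, then for every neighbourhood `U` of `w₁` and all `s` near `s₀`
the slice `H(s, ·)` has a zero in `U`.  The map `Ψ(s, w) = (s, H(s, w))` on a ball around `(s₀, w₁)` (an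
analytic set of pure dimension `3`) has the isolated fibre point `(s₀, w₁)` (regular of codimension `3`), so
`Ψ` is open at `(s₀, w₁)` by `SCV.image_inter_mem_nhds_of_fibre` (`m = 3`, `r = 0`).
[cite: Fischer1976, §3.9 Prop.] [cite: Chirka1989, §2.3, §3.8] -/
theorem eventually_exists_zero_nhds {H : ℂ × (ℂ × ℂ) → ℂ × ℂ} {Ω₀ : Set (ℂ × (ℂ × ℂ))}
    (hΩ₀ : IsOpen Ω₀) (hH : DifferentiableOn ℂ H Ω₀) {s₀ : ℂ} {w₁ : ℂ × ℂ} (hmem : (s₀, w₁) ∈ Ω₀)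
    (hzero : H (s₀, w₁) = 0) (hiso : ∀ᶠ w in 𝓝[≠] w₁, H (s₀, w) ≠ 0) {U : Set (ℂ × ℂ)}
    (hU : U ∈ 𝓝 w₁) : ∀ᶠ s in 𝓝 s₀, ∃ w ∈ U, H (s, w) = 0 := by
  -- a ball `Ω ⊆ Ω₀` around `a = (s₀, w₁)`; the map `Ψ`
  obtain ⟨ρ, hρ, hballΩ₀⟩ := Metric.isOpen_iff.1 hΩ₀ _ hmem
  set Ω : Set (ℂ × (ℂ × ℂ)) := ball ((s₀, w₁) : ℂ × (ℂ × ℂ)) ρ with hΩ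
  set Ψ : ℂ × (ℂ × ℂ) → ℂ × (ℂ × ℂ) := fun x => (x.1, H x) with hΨ
  have hΩo : IsOpen Ω := isOpen_ball
  have haΩ : ((s₀, w₁) : ℂ × (ℂ × ℂ)) ∈ Ω := mem_ball_self hρ
  have hA : ∀ x ∈ Ω, IsZeroSetAt Ω x := fun x hx =>
    ⟨Ω, hΩo, hx, 0, fun _ => 0, differentiableOn_const _, by
      ext y
      simp⟩
  have hΨd : DifferentiableOn ℂ Ψ Ω := differentiableOn_fst.prodMk (hH.mono hballΩ₀)
  have hrank : Module.finrank ℂ (ℂ × (ℂ × ℂ)) = 3 := by simp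
  have hpure : ∀ x ∈ regLocus Ω, IsRegPt Ω (Module.finrank ℂ (ℂ × (ℂ × ℂ)) - 3) x := by
    intro x hx
    rw [hrank, Nat.sub_self]
    exact Literature.Geometry.Kaehler.SCV.isRegPt_zero_of_ball_subset Subset.rfl hx.1
  have hr : 0 + Module.finrank ℂ (ℂ × (ℂ × ℂ)) = 3 := by rw [hrank]
  -- an isolating open neighbourhood `N₂` of `w₁`
  obtain ⟨N₂, hN₂o, hw₁N₂, hN₂⟩ : ∃ N₂ : Set (ℂ × ℂ), IsOpen N₂ ∧ w₁ ∈ N₂ ∧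
      ∀ w ∈ N₂, w ≠ w₁ → H (s₀, w) ≠ 0 := by
    have h1 := hiso
    rw [eventually_nhdsWithin_iff] at h1
    obtain ⟨N₂, hN₂sub, hN₂o, hw₁⟩ := _root_.mem_nhds_iff.1 h1
    exact ⟨N₂, hN₂o, hw₁, fun w hw hne => hN₂sub hw hne⟩
  -- the fibre of `Ψ` through `a` is `{a}` near `a`
  have hΨa : Ψ (s₀, w₁) = (s₀, 0) := by simp [hΨ, hzero]
  have haFb : ((s₀, w₁) : ℂ × (ℂ × ℂ)) ∈ Ω ∩ Ψ ⁻¹' {Ψ (s₀, w₁)} := ⟨haΩ, rfl⟩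
  have hNo : IsOpen (Prod.snd ⁻¹' N₂ : Set (ℂ × (ℂ × ℂ))) := hN₂o.preimage continuous_snd
  have haN : ((s₀, w₁) : ℂ × (ℂ × ℂ)) ∈ (Prod.snd ⁻¹' N₂ : Set (ℂ × (ℂ × ℂ))) := hw₁N₂
  have hFbN : (Ω ∩ Ψ ⁻¹' {Ψ (s₀, w₁)}) ∩ (Prod.snd ⁻¹' N₂ : Set (ℂ × (ℂ × ℂ))) ⊆ {(s₀, w₁)} := by
    rintro ⟨s, w⟩ ⟨⟨-, hxΨ⟩, hxN⟩
    rw [mem_preimage, mem_singleton_iff, hΨa] at hxΨ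
    simp only [hΨ, Prod.mk.injEq] at hxΨ
    obtain ⟨hs, hHw⟩ := hxΨ
    subst hs
    have hw : w = w₁ := by
      by_contra hne
      exact hN₂ w hxN hne hHw
    subst hw
    rfl
  have hfib : ∀ᶠ x in 𝓝 ((s₀, w₁) : ℂ × (ℂ × ℂ)), x ∈ Ω ∩ Ψ ⁻¹' {Ψ (s₀, w₁)} →
      ∀ q, IsRegPt (Ω ∩ Ψ ⁻¹' {Ψ (s₀, w₁)}) q x → Module.finrank ℂ (ℂ × (ℂ × ℂ)) ≤ q + 0 := by
    filter_upwards [hNo.mem_nhds haN] with x hxN hxFb q hq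
    have hxa : x = (s₀, w₁) := hFbN ⟨hxFb, hxN⟩
    subst hxa
    have hreg : IsRegPt (Ω ∩ Ψ ⁻¹' {Ψ (s₀, w₁)}) (Module.finrank ℂ (ℂ × (ℂ × ℂ))) (s₀, w₁) :=
      Literature.Geometry.Kaehler.SCV.isRegularPointOfCodim_iff_isRegPt.1
        (Literature.Geometry.Kaehler.isRegularPointOfCodim_finrank_of_inter_subset_singleton
          (E := ℂ × (ℂ × ℂ)) hNo haN haFb hFbN)
    have := Literature.Geometry.Kaehler.SCV.IsRegPt.codim_unique haFb hq hreg
    omega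
  have hU' : (Prod.snd ⁻¹' U : Set (ℂ × (ℂ × ℂ))) ∈ 𝓝 ((s₀, w₁) : ℂ × (ℂ × ℂ)) :=
    continuous_snd.continuousAt.preimage_mem_nhds hU
  have himg := Literature.Geometry.Kaehler.SCV.image_inter_mem_nhds_of_fibre hΩo Subset.rfl hA haΩ hΨd
    (m := 3) (by rw [hrank]) hpure (r := 0) hr hfib hU'
  rw [hΨa] at himg
  have hsec : Tendsto (fun s : ℂ => ((s, (0 : ℂ × ℂ)) : ℂ × (ℂ × ℂ))) (𝓝 s₀) (𝓝 (s₀, 0)) :=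
    (continuous_id.prodMk continuous_const).continuousAt.tendsto
  filter_upwards [hsec.eventually_mem himg] with s hs
  obtain ⟨⟨s', w⟩, ⟨-, hxU⟩, hx⟩ := hs
  simp only [hΨ, Prod.mk.injEq] at hx
  obtain ⟨hs', hHw⟩ := hx
  subst hs'
  exact ⟨w, hxU, hHw⟩

/-- **`RoucheMaps` holds** (the tree's named input FACT A1 of SUB-PIECE A, part 04 l.196, discharged):
Rouché's theorem for holomorphic self-maps of the bidisc, multiplicity-free form with finiteness.  Along the
straight homotopy `H(s, w) = f w + s (g w − f w)` no zero lies on the sphere for `s ∈ [0, 1]`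
(`‖f − g‖ < ‖f‖` there); the set of `s ∈ [0, 1]` for which `H(s, ·)` has a zero in the open ball contains `0`,
is closed (compactness of `[0,1] × closedBall`) and right-open (`eventually_exists_zero_nhds` at an isolated
zero, isolated by `finite_zeros_ball`), hence is all of `[0, 1]`; and `H(1, ·) = g`.  Finiteness of the zeros
of `g` in the ball is `finite_zeros_ball`. [cite: Chirka1989, §10.3 Thm. 1, p. 124; §3.3 Prop. 1]
[cite: Fischer1976, §3.9 Prop.] -/
theorem roucheMaps_holds : RoucheMaps := by
  intro f g w₀ r hr hf hg hf0 hfg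
  -- the homotopy
  set H : ℂ × (ℂ × ℂ) → ℂ × ℂ := fun x => f x.2 + x.1 • (g x.2 - f x.2) with hH
  -- no zeros on the sphere for real `s ∈ [0, 1]`
  have hsph : ∀ s : ℝ, s ∈ Icc (0 : ℝ) 1 → ∀ w ∈ sphere w₀ r, H ((s : ℂ), w) ≠ 0 := by
    intro s hs w hw hzero
    have h1 := hfg w hw
    have h2 : f w = -((s : ℂ) • (g w - f w)) := eq_neg_of_add_eq_zero_left hzero
    have h3 : ‖f w‖ = s * ‖f w - g w‖ :=
      calc ‖f w‖ = ‖-((s : ℂ) • (g w - f w))‖ := congrArg norm h2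
        _ = s * ‖f w - g w‖ := by
          rw [norm_neg, norm_smul, Complex.norm_real, Real.norm_eq_abs, abs_of_nonneg hs.1,
            norm_sub_rev]
    have h4 : s * ‖f w - g w‖ ≤ ‖f w - g w‖ := mul_le_of_le_one_left (norm_nonneg _) hs.2
    linarith
  -- the domain of holomorphy `ℂ × A`, `A ⊇ closedBall w₀ r` open
  set A : Set (ℂ × ℂ) := {w | AnalyticAt ℂ f w} ∩ {w | AnalyticAt ℂ g w} with hA
  have hAo : IsOpen A := (isOpen_analyticAt ℂ f).inter (isOpen_analyticAt ℂ g)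
  have hcbA : closedBall w₀ r ⊆ A := fun w hw => ⟨hf w hw, hg w hw⟩
  have hΩ₀o : IsOpen (univ ×ˢ A : Set (ℂ × (ℂ × ℂ))) := isOpen_univ.prod hAo
  have hHd : DifferentiableOn ℂ H (univ ×ˢ A) := by
    rintro ⟨s, w⟩ ⟨-, hwf, hwg⟩
    have hf' : DifferentiableAt ℂ (fun x : ℂ × (ℂ × ℂ) => f x.2) (s, w) :=
      hwf.differentiableAt.comp _ differentiableAt_snd
    have hg' : DifferentiableAt ℂ (fun x : ℂ × (ℂ × ℂ) => g x.2) (s, w) :=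
      hwg.differentiableAt.comp _ differentiableAt_snd
    exact (hf'.add (differentiableAt_fst.smul (hg'.sub hf'))).differentiableWithinAt
  have hHs : ∀ s : ℂ, AnalyticOnNhd ℂ (fun w => H (s, w)) (closedBall w₀ r) := by
    intro s w hw
    have h1 : AnalyticAt ℂ f w := hf w hw
    have h2 : AnalyticAt ℂ g w := hg w hw
    have h3 : AnalyticAt ℂ (fun w => g w - f w) w := h2.fun_sub h1
    have h4 : AnalyticAt ℂ (fun w => s • (g w - f w)) w := (analyticAt_const (v := s)).fun_smul h3
    show AnalyticAt ℂ (fun w => f w + s • (g w - f w)) w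
    exact h1.fun_add h4
  -- the set of real parameters carrying a zero in the open ball
  set S : Set ℝ := {s | ∃ w ∈ ball w₀ r, H ((s : ℂ), w) = 0} with hS
  have h0S : (0 : ℝ) ∈ S := ⟨w₀, mem_ball_self hr, by simp [hH, hf0]⟩
  -- `S ∩ [0, 1]` is closed: it is the projection of a compact set
  have hclosed : IsClosed (S ∩ Icc 0 1) := by
    set K : Set (ℝ × (ℂ × ℂ)) :=
      (Icc (0 : ℝ) 1 ×ˢ closedBall w₀ r) ∩ (fun p => H ((p.1 : ℂ), p.2)) ⁻¹' {0} with hK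
    have hc1 : Continuous (fun p : ℝ × (ℂ × ℂ) => (((p.1 : ℂ), p.2) : ℂ × (ℂ × ℂ))) :=
      (Complex.continuous_ofReal.comp continuous_fst).prodMk continuous_snd
    have hcont : ContinuousOn (fun p : ℝ × (ℂ × ℂ) => H ((p.1 : ℂ), p.2))
        (Icc (0 : ℝ) 1 ×ˢ closedBall w₀ r) :=
      hHd.continuousOn.comp hc1.continuousOn fun p hp => ⟨mem_univ _, hcbA hp.2⟩
    have hKc : IsCompact K :=
      (isCompact_Icc.prod (isCompact_closedBall w₀ r)).of_isClosed_subset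
        (hcont.preimage_isClosed_of_isClosed (isClosed_Icc.prod isClosed_closedBall)
          isClosed_singleton) inter_subset_left
    have hSK : S ∩ Icc 0 1 = Prod.fst '' K := by
      ext s
      constructor
      · rintro ⟨⟨w, hw, hw0⟩, hs⟩
        exact ⟨(s, w), ⟨⟨hs, ball_subset_closedBall hw⟩, hw0⟩, rfl⟩
      · rintro ⟨⟨s', w⟩, ⟨⟨hs', hw⟩, hw0⟩, rfl⟩
        have hw0' : H ((s' : ℂ), w) = 0 := hw0
        refine ⟨⟨w, ?_, hw0'⟩, hs'⟩
        have hns : w ∉ sphere w₀ r := fun hsp => hsph s' hs' w hsp hw0'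
        rw [mem_closedBall] at hw
        rw [mem_sphere] at hns
        exact mem_ball.2 (lt_of_le_of_ne hw hns)
    rw [hSK]
    exact (hKc.image continuous_fst).isClosed
  -- `S` is right-open at every `s ∈ S ∩ [0, 1)`: persistence of an isolated zero
  have hstep : ∀ s ∈ S ∩ Ico (0 : ℝ) 1, S ∈ 𝓝[>] s := by
    rintro s ⟨⟨w₁, hw₁, hzero⟩, hs⟩
    have hsI : s ∈ Icc (0 : ℝ) 1 := ⟨hs.1, hs.2.le⟩
    obtain ⟨-, hisoF⟩ := finite_zeros_ball (hHs s) (hsph s hsI)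
    have hiso : ∀ᶠ w in 𝓝[≠] w₁, H ((s : ℂ), w) ≠ 0 := by
      have h1 := hisoF w₁
      have h2 : ∀ᶠ w in 𝓝[≠] w₁, w ∈ ball w₀ r :=
        mem_nhdsWithin_of_mem_nhds (isOpen_ball.mem_nhds hw₁)
      filter_upwards [h1, h2] with w hw hwb
      exact fun h0 => hw ⟨hwb, h0⟩
    have hper := eventually_exists_zero_nhds hΩ₀o hHd (s₀ := (s : ℂ)) (w₁ := w₁)
      ⟨mem_univ _, hcbA (ball_subset_closedBall hw₁)⟩ hzero hiso (isOpen_ball.mem_nhds hw₁)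
    have hreal : ∀ᶠ t : ℝ in 𝓝 s, ∃ w ∈ ball w₀ r, H ((t : ℂ), w) = 0 :=
      Complex.continuous_ofReal.continuousAt.tendsto.eventually hper
    exact mem_nhdsWithin_of_mem_nhds hreal
  have hIcc : Icc (0 : ℝ) 1 ⊆ S := hclosed.Icc_subset_of_forall_mem_nhdsWithin h0S hstep
  obtain ⟨w, hw, hw0⟩ := hIcc (show (1 : ℝ) ∈ Icc (0 : ℝ) 1 from ⟨zero_le_one, le_rfl⟩)
  have hgs : ∀ w ∈ sphere w₀ r, g w ≠ 0 := fun w hw hg0 => by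
    have h1 := hfg w hw
    rw [hg0, sub_zero] at h1
    exact lt_irrefl _ h1
  refine ⟨⟨w, hw, ?_⟩, (finite_zeros_ball hg hgs).1⟩
  simpa [hH] using hw0

end FactA1

/-! ## §3  READ-OUTS: SUB-PIECE A hypothesis-free; the cell modulo {CurveSelection, Ax (proved), IsolatedPointBound} -/

section CellClosure

open Summit.Schanuel.Schanuel.Theorems.RootDecomp1KHyper (LWMeasure)
open Summit.Schanuel.Schanuel.Theorems.RootDecomp1KHyper.HyperCell (HyperLiouville ExplicitRatExpApprox)
open Summit.Schanuel.Schanuel.Theorems.RootDecomp1KGeneric (LiouvilleOrder)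
open Summit.Schanuel.Schanuel.Theorems.RootDecomp1KFiniteOrderCell (towerNumber)
open Summit.Schanuel.Schanuel.Theorems.RootDecomp1BFedFlagCore (polarDeg)

/-- **SUB-PIECE A HYPOTHESIS-FREE**: the tree's `AnalyticMovingZero` (part 04 §A: the moved zero `θ' → θ = (e, eⁱ)`
with `|θ' − θ| ≤ C |ρ − r|^{1/N}`), by part 04's `analyticMovingZero_of_facts` with BOTH print inputs discharged. -/
theorem analyticMovingZero_holds : AnalyticMovingZero :=
  analyticMovingZero_of_facts roucheMaps_holds isolatedZeroLowerBound_holds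

/-- `ApproxOfIsolated ρ` (piece M′) for EVERY real `ρ`, modulo the ONE print fact `IsolatedPointBound` (B). -/
theorem approxOfIsolated_of_isolatedPointBound (hB : IsolatedPointBound) (ρ : ℝ) : ApproxOfIsolated ρ :=
  approxOfIsolated_of_facts analyticMovingZero_holds hB ρ

/-- **THE CELL's MZ INPUT `MovingZeroApprox ρ` FOR EVERY REAL `ρ`** modulo THREE named inputs
{`CurveSelection` (T, print), `AxRankBoundLaurent` (Ax 1971, tree-PROVED, by name), `IsolatedPointBound` (B, print)}
— part 13's `movingZeroApprox_of_all_facts` with `RoucheMaps` and `IsolatedZeroLowerBound` discharged. -/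
theorem movingZeroApprox_of_three_facts (hCS : CurveSelection) (hAx : AxRankBoundLaurent)
    (hB : IsolatedPointBound) (ρ : ℝ) : MovingZeroApprox ρ :=
  movingZeroApprox_of_all_facts hCS hAx roucheMaps_holds isolatedZeroLowerBound_holds hB ρ

/-- **THE CELL X(2) AT `(1, ρ)` for every real `ρ` of exponential Liouville order `8`**, modulo the two registered
E-side facts (`LWMeasure`, `ExplicitRatExpApprox`) and the three remaining moving-zero inputs. -/
theorem four_le_polarDeg_one_of_three_facts (hLW : LWMeasure) (hX : ExplicitRatExpApprox) (hCS : CurveSelection)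
    (hAx : AxRankBoundLaurent) (hB : IsolatedPointBound) {ρ : ℝ} (hρ : LiouvilleOrder 8 ρ) :
    ((2 + 2 : ℕ) : Cardinal) ≤ polarDeg ![(1 : ℝ), ρ] :=
  four_le_polarDeg_one_of_all_facts hLW hX hCS hAx roucheMaps_holds isolatedZeroLowerBound_holds hB hρ

/-- … the swapped cell `(ρ, 1)`. -/
theorem four_le_polarDeg_swap_of_three_facts (hLW : LWMeasure) (hX : ExplicitRatExpApprox) (hCS : CurveSelection)
    (hAx : AxRankBoundLaurent) (hB : IsolatedPointBound) {ρ : ℝ} (hρ : LiouvilleOrder 8 ρ) :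
    ((2 + 2 : ℕ) : Cardinal) ≤ polarDeg ![ρ, (1 : ℝ)] :=
  four_le_polarDeg_swap_of_all_facts hLW hX hCS hAx roucheMaps_holds isolatedZeroLowerBound_holds hB hρ

/-- … the hyper-Liouville class (1K item 33363's class). -/
theorem four_le_polarDeg_one_hyper_of_three_facts (hLW : LWMeasure) (hX : ExplicitRatExpApprox)
    (hCS : CurveSelection) (hAx : AxRankBoundLaurent) (hB : IsolatedPointBound) {ρ : ℝ} (hρ : HyperLiouville ρ) :
    ((2 + 2 : ℕ) : Cardinal) ≤ polarDeg ![(1 : ℝ), ρ] :=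
  four_le_polarDeg_one_hyper_of_all_facts hLW hX hCS hAx roucheMaps_holds isolatedZeroLowerBound_holds hB hρ

/-- **X(2) AT `(1, ρ_T)`, `ρ_T = towerNumber 9` NOT hyper-Liouville**, modulo the same named inputs. -/
theorem four_le_polarDeg_one_rhoT_of_three_facts (hLW : LWMeasure) (hX : ExplicitRatExpApprox)
    (hCS : CurveSelection) (hAx : AxRankBoundLaurent) (hB : IsolatedPointBound) :
    ((2 + 2 : ℕ) : Cardinal) ≤ polarDeg ![(1 : ℝ), towerNumber 9] :=
  four_le_polarDeg_one_rhoT_of_all_facts hLW hX hCS hAx roucheMaps_holds isolatedZeroLowerBound_holds hB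

end CellClosure

end Summit.Schanuel.Schanuel.Theorems.RootDecomp1BMovingZero
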